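import Mathlib
import HarnessLib

/-!
# Route `F4SubCurvatureDoor`, crux `SubCurvatureKernel` ⟨stmt-QuantumFields-23036⟩ — soft half, input (C) «continuity off 0»,
# part 3: a VAGUE CLUSTER POINT of a bounded sequence of finite measures (one-point compactification)

Helper file (`--supports stmt-QuantumFields-23036 --as helper`; free-hands seat `ym-line-frs-p2` g18).  Pure measure theory,
kernel-generic; definition-free, 0 sorry, standard axioms.  No item is closed; no summit, no crux and no mass gap is proved by this file.

WHAT.  ★ `exists_finiteMeasure_mapClusterPt`: on a locally compact Hausdorff Borel space `X`, every sequence of finite measures `νₙ`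
with `mass νₙ ≤ C` has a finite measure `ν` with `mass ν ≤ C` such that, for EVERY bounded continuous `Φ : X → ℝ` vanishing at
infinity, `∫ Φ dν` is a cluster point of `(∫ Φ dνₙ)ₙ` (the same `ν` for all `Φ`).  Proof: push the `νₙ` to the one-point
compactification `OnePoint X` (compact Hausdorff), take a cluster point `ν̄` of the image sequence in the compact set `{mass ≤ C}`
(Mathlib's ✓`isCompact_setOf_finiteMeasure_le_of_compactSpace`, file `Prokhorov`), and pull `ν̄` back along the open embedding
`X → OnePoint X`; the mass that `ν̄` puts at `∞` (the escaped mass) is invisible to test functions vanishing at infinity, and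
`μ ↦ ∫ Φ̄ dμ` is continuous for the weak topology.  Also `eq_of_mapClusterPt_of_tendsto`: a convergent real sequence has no other
cluster point — so `∫ Φ dν = lim ∫ Φ dνₙ` whenever the latter exists.

WHY.  Step (ii) of input (C) (HOME INBOX owner g23 16:54:59Z, this seat 18:5xZ): the tilted Laplace–Fourier measures `e^{−t₀E} μ_ε` of
the mollified kernels (✓`exists_laplaceFourier_mollified`) have uniformly bounded mass; a vague cluster point represents `K` on a
half-space by a jointly continuous function (next file).  No Riesz–Markov argument by hand is needed.

HONEST LABEL: measure-theoretic plumbing toward input (C) of the SOFT half of ⟨23036⟩; the SUB-CURVATURE clause is the crux, untouched;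
⟨23036⟩ is an open problem; the Yang–Mills mass gap is NOT proved; no summit is proved by a line.
-/

set_option autoImplicit false

noncomputable section

open scoped Topology NNReal ENNReal BoundedContinuousFunction
open MeasureTheory Filter Set Function OnePoint

namespace Summit.QuantumFields.YangMills.Theorems.F4SubCurvatureDoorSubCurvatureKernelVagueCluster

/-- A convergent real sequence has no cluster point other than its limit. [folklore] -/
theorem eq_of_mapClusterPt_of_tendsto {a L : ℝ} {u : ℕ → ℝ} (ha : MapClusterPt a atTop u)
    (hu : Tendsto u atTop (𝓝 L)) : a = L := by
  have h : ClusterPt a (𝓝 L) := ClusterPt.mono ha hu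
  exact t2_iff_nhds.1 inferInstance h

/-- The extension by `0` at `∞` of a bounded continuous function vanishing at infinity, as a bounded continuous function on the
one-point compactification. [folklore] -/
theorem exists_extension_onePoint {X : Type*} [TopologicalSpace X] [T2Space X] (Φ : X →ᵇ ℝ)
    (hΦ : Tendsto Φ (cocompact X) (𝓝 0)) :
    ∃ Ψ : OnePoint X →ᵇ ℝ, (∀ x : X, Ψ x = Φ x) ∧ Ψ ∞ = 0 := by
  have h : Tendsto (Φ : C(X, ℝ)) (coclosedCompact X) (𝓝 0) := by
    rw [Filter.coclosedCompact_eq_cocompact]; exact hΦ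
  refine ⟨BoundedContinuousFunction.mkOfCompact (OnePoint.continuousMapMk (Φ : C(X, ℝ)) 0 h), fun x => rfl, rfl⟩

/-- ★ **A vague cluster point of a bounded sequence of finite measures.**  On a locally compact Hausdorff Borel space, a sequence of
finite measures of mass `≤ C` has a finite measure `ν` of mass `≤ C` such that for every bounded continuous `Φ` vanishing at
infinity, `∫ Φ dν` is a cluster point of `n ↦ ∫ Φ dνₙ`. [cite: Billingsley1999, Thm. 5.1 (Prokhorov); vague form, folklore] -/
theorem exists_finiteMeasure_mapClusterPt {X : Type*} [TopologicalSpace X] [LocallyCompactSpace X] [T2Space X]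
    [MeasurableSpace X] [BorelSpace X] (ν : ℕ → FiniteMeasure X) (C : ℝ≥0) (hν : ∀ n, (ν n).mass ≤ C) :
    ∃ νlim : FiniteMeasure X, νlim.mass ≤ C ∧ ∀ Φ : X →ᵇ ℝ, Tendsto Φ (cocompact X) (𝓝 0) →
      MapClusterPt (∫ x, Φ x ∂(νlim : Measure X)) atTop (fun n => ∫ x, Φ x ∂(ν n : Measure X)) := by
  classical
  -- the one-point compactification with its Borel structure
  letI : MeasurableSpace (OnePoint X) := borel (OnePoint X)
  haveI : BorelSpace (OnePoint X) := ⟨rfl⟩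
  set ι : X → OnePoint X := (↑) with hι
  have hιe : MeasurableEmbedding ι := OnePoint.isOpenEmbedding_coe.measurableEmbedding
  have hιm : Measurable ι := hιe.measurable
  have hrange : MeasurableSet (range ι) := OnePoint.isOpen_range_coe.measurableSet
  -- the image sequence lives in the compact set `{mass ≤ C}`
  set νb : ℕ → FiniteMeasure (OnePoint X) := fun n => (ν n).map ι with hνb
  have hνb_mass : ∀ n, (νb n).mass ≤ C := fun n => ((ν n).mass_map_le ι).trans (hν n)
  set S : Set (FiniteMeasure (OnePoint X)) := {μ | μ.mass ≤ C} with hS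
  have hSc : IsCompact S := isCompact_setOf_finiteMeasure_le_of_compactSpace (OnePoint X) C
  have hle : map νb atTop ≤ 𝓟 S := le_principal_iff.2 (mem_map.2 (Eventually.of_forall fun n => hνb_mass n))
  obtain ⟨νbar, hνbarS, hcl⟩ := hSc.exists_clusterPt hle
  -- pull back along the embedding
  set νl : Measure X := (νbar : Measure (OnePoint X)).comap ι with hνl
  have hνl_map : νl.map ι = (νbar : Measure (OnePoint X)).restrict (range ι) := hιe.map_comap _
  haveI : IsFiniteMeasure νl := by
    refine ⟨?_⟩
    rw [hνl, hιe.comap_apply, image_univ]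
    exact measure_lt_top _ _
  set νlim : FiniteMeasure X := ⟨νl, inferInstance⟩ with hνlim
  have hνlim_coe : (νlim : Measure X) = νl := rfl
  refine ⟨νlim, ?_, fun Φ hΦ => ?_⟩
  · -- mass
    have h1 : (νlim : Measure X) univ ≤ (νbar : Measure (OnePoint X)) univ := by
      rw [hνlim_coe, hνl, hιe.comap_apply, image_univ]
      exact measure_mono (subset_univ _)
    have h2 : (νlim.mass : ℝ≥0∞) ≤ (νbar.mass : ℝ≥0∞) := by
      rw [FiniteMeasure.ennreal_mass, FiniteMeasure.ennreal_mass]; exact h1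
    exact (ENNReal.coe_le_coe.1 h2).trans hνbarS
  · -- the extension of `Φ` and the two integral identities
    obtain ⟨Ψ, hΨ, hΨinf⟩ := exists_extension_onePoint Φ hΦ
    have hint_n : ∀ n, ∫ y, Ψ y ∂(νb n : Measure (OnePoint X)) = ∫ x, Φ x ∂(ν n : Measure X) := by
      intro n
      rw [hνb]
      dsimp only
      rw [FiniteMeasure.toMeasure_map, hιe.integral_map]
      exact integral_congr_ae (Eventually.of_forall fun x => hΨ x)
    have hint_lim : ∫ y, Ψ y ∂(νbar : Measure (OnePoint X)) = ∫ x, Φ x ∂νl := by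
      have hΨi : Integrable (fun y => Ψ y) (νbar : Measure (OnePoint X)) := Ψ.integrable _
      have h0 : ∫ y in ({(OnePoint.infty : OnePoint X)} : Set (OnePoint X)), Ψ y ∂(νbar : Measure (OnePoint X)) = 0 :=
        setIntegral_eq_zero_of_forall_eq_zero fun y hy => by rw [mem_singleton_iff.1 hy]; exact hΨinf
      rw [← integral_add_compl hrange hΨi, OnePoint.compl_range_coe, h0, add_zero, ← hνl_map, hιe.integral_map]
      exact integral_congr_ae (Eventually.of_forall fun x => hΨ x)
    -- continuity of `μ ↦ ∫ Ψ dμ` transports the cluster point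
    have hg : Continuous fun μ : FiniteMeasure (OnePoint X) => ∫ y, Ψ y ∂(μ : Measure (OnePoint X)) :=
      FiniteMeasure.continuous_integral_boundedContinuousFunction Ψ
    have hcl' := hcl.map hg.continuousAt
      (Filter.tendsto_map (f := fun μ : FiniteMeasure (OnePoint X) => ∫ y, Ψ y ∂(μ : Measure (OnePoint X)))
        (x := map νb atTop))
    rw [Filter.map_map] at hcl'
    have hfun : ((fun μ : FiniteMeasure (OnePoint X) => ∫ y, Ψ y ∂(μ : Measure (OnePoint X))) ∘ νb) =
        fun n => ∫ x, Φ x ∂(ν n : Measure X) := funext fun n => hint_n n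
    rw [hfun, hint_lim, ← hνlim_coe] at hcl'
    exact hcl'

end Summit.QuantumFields.YangMills.Theorems.F4SubCurvatureDoorSubCurvatureKernelVagueCluster

end
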